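import Literature.MathematicalPhysics.QuantumFieldTheory.Balaban1983to89.B15HDecayLeaves
import Literature.MathematicalPhysics.QuantumFieldTheory.Balaban1983to89.B15GammaSmallness

/-!
# `Balaban1983to89.B15Ineq131Input` — [Balaban1989LargeFieldI] pp. 183–184, the `ℍ_{j,□}`-input of (1.31): *"The
# exponential decay property of ℍ_{j,□} implies that on the cube □^∼ this function and its covariant derivatives can be
# bounded by B₃exp(−δ2M₂R_j)22d²ε_j < (β/10)ε_j"* — DERIVED from [15] (190) (one localised piece) and the γ-clause

statement-level skeleton of published theorems with citation tags; proofs where landed; nothing here is a claim about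
the Yang–Mills mass gap.

CITATION HEADER (lean-in-tree rule 2026-08-18).  T. Bałaban, *Large field renormalization. I. The basic step of the 𝐑
operation*, Commun. Math. Phys. **122**, 175–202 (1989), doi:10.1007/BF01257412, bib `Balaban1989LargeFieldI` (cell
paper B15; PDF held `paper:balaban1989-cmp122-large-field-i`; pp. 183–184 = PDF 9–10, OCR pages `p0009.txt`/`p0010.txt`
and the x2 renders).  "[15]" = [Balaban1985Variational] (190) p. 308 (`B11SectG.Ineq190`); "[3]" = [Balaban1984PropagatorsII]
(2.61) (`B11SectG.RowSum`); "[III]" = [Balaban1988Convergent] (2.5) (`B14.IsRj`).  WHAT IS REPRODUCED: SKELETON rows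
`B15.Eq1.30` (its size/localisation sentence) and `B15.Eq1.31` (its ℍ-input), unit `lit-balaban-r12` gen 8, HOME
`run/shared/lean/pub/lit-balaban/` (`lit-balaban-r12/ROWS-B15.md`).  Used BY NAME, nothing restated:
`B15HDecayLeaves.loc_le_of_meanValue` (one localised piece through (190)), `B15GammaSmallness.ineq131_input_of_gamma`
(`B₃e^{−δ2M₂R_j}22d²ε_j < (β/10)ε_j` from the explicit γ-clause).

THE PRINTED TEXT (pp. 183–184, verbatim; v1.1: three clipped words restored — «of the function», «almost the whole»,
«∂U_{j,□}» —, `lit-balaban-r12/QUOTE-AUDIT-B15.md` L1; docstring only): *"The field in the argument of the function ℍ_{j,□} is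
equal to 0 on almost the whole cube □^{∼4}, except a boundary layer of the width 2M₁ in the lattice T_ξ, ξ = L^{−j}. On this
boundary the field can be bounded by 22d²ε_j by the argument leading to the estimate (1.65) in [14]. The exponential decay
property of ℍ_{j,□} implies that on the cube □^∼ this function and its covariant derivatives can be bounded by
B₃exp(−δ2M₂R_j)22d²ε_j < (β/10)ε_j. Estimating ∂U_{j,□} as in (3.8) [III] we obtain [(1.31)]"*.

WHAT IS PROVED (0 `sorry`, no `def`, no new `Prop`).  `boundH130_of_ineq190` — `sH ≤ B₃e^{−δ2M₂R_j}22d²ε_j` for any local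
size `bout` of `ℍ_{j,□}` (the function or one of its covariant derivatives, weights inside) from (190) at every base point,
(2.61), the argument field of B-size `≤ 22d²ε_j` vanishing on the blocks closer than `D` with `δ2M₂R_j ≤ τD` (the layer at
`∂□^{∼4}` seen from `□^∼`), `Cκ_Bc ≤ B₃`, mean-value domination; `ineq131_input_of_ineq190_gamma` — `sH < (β/10)ε_j` with
the last step from `B15GammaSmallness.ineq131_input_of_gamma` ((2.5) for `R_j`, `0 < g_j ≤ γ`, `log γ⁻² ≥ 1`, `δ2M₂ ≥ 1`,
`B₃22d²γ² < β/10`, `ε_j > 0`) — the two `ℍ`-hypotheses of p29's `B14Ineq38Proof.ineq131_first` in their printed form.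
HONEST SCOPE.  As in `B15HDecayLeaves`.  NOT summit progress.
-/

namespace Literature.MathematicalPhysics.QuantumFieldTheory.Balaban1983to89.B15Ineq131Input

open Literature.MathematicalPhysics.QuantumFieldTheory.Balaban1983to89
open B11SectG B15HDecayLeaves B15GammaSmallness

variable {g : B6.Geometry} {FB FA : Type} [AddCommGroup FB] [Module ℝ FB] [AddCommGroup FA] [Module ℝ FA]

/-- **pp. 183–184**: *"on the cube □^∼ this function [ℍ_{j,□}] and its covariant derivatives can be bounded by
B₃exp(−δ2M₂R_j)22d²ε_j"* — from (190) for the size `bout` at every base point, (2.61) at rate `σ`, `τ ≥ 0` with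
`σ + τ ≤ ⅛δ₀`, the argument field of B-size `≤ 22d²ε_j` (the `2M₁`-layer at `∂□^{∼4}`) vanishing on the blocks `y′` with
`d(y, y′) < D`, `δ2M₂R ≤ τD` (`R = R_j`), `Cκ_Bc ≤ B₃`, and the mean-value domination.
[cite: Balaban1989LargeFieldI, (1.30) p.183; Balaban1985Variational, (190) p.308] -/
theorem boundH130_of_ineq190 {T : Type*} {bB : BlockNorm g FB} {bout : BlockNorm g FA}
    {dH : T → FB →ₗ[ℝ] FA} {C δ₀ σ τ c D B₃ δ M₂ R d εj : ℝ}
    (h190 : ∀ t, Ineq190 bB bout (dH t) C δ₀) (hC : 0 ≤ C) (hd : ∀ a b : g.Site, 0 ≤ g.dist a b)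
    (hrow : RowSum g σ c) (hτ : 0 ≤ τ) (hστ : σ + τ ≤ δ₀ / 8) (B : FB) (y : g.Site)
    (hm : ∀ y', bB.loc y' B ≤ 22 * d ^ 2 * εj) (hD : ∀ y', bB.loc y' B ≠ 0 → D ≤ g.dist y y')
    {HB : FA} (hmv : ∀ s : ℝ, (∀ t, bout.loc y (dH t B) ≤ s) → bout.loc y HB ≤ s)
    (hgeom : δ * 2 * M₂ * R ≤ τ * D) (hCB : C * bB.κ * c ≤ B₃) (hB₃ : 0 ≤ B₃) (hε : 0 ≤ εj) :
    bout.loc y HB ≤ B₃ * Real.exp (-(δ * 2 * M₂ * R)) * (22 * d ^ 2) * εj := by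
  have h := loc_le_of_meanValue h190 hC hd hrow hτ hστ B hm y hD hmv
  have hexp : Real.exp (-(τ * D)) ≤ Real.exp (-(δ * 2 * M₂ * R)) := Real.exp_le_exp.mpr (by linarith)
  have ha : 0 ≤ 22 * d ^ 2 * εj := by positivity
  have h2 : C * bB.κ * c * (22 * d ^ 2 * εj) * Real.exp (-(τ * D))
      ≤ B₃ * (22 * d ^ 2 * εj) * Real.exp (-(δ * 2 * M₂ * R)) :=
    mul_le_mul (mul_le_mul_of_nonneg_right hCB ha) hexp (Real.exp_nonneg _) (by positivity)
  calc bout.loc y HB ≤ B₃ * (22 * d ^ 2 * εj) * Real.exp (-(δ * 2 * M₂ * R)) := h.trans h2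
    _ = B₃ * Real.exp (-(δ * 2 * M₂ * R)) * (22 * d ^ 2) * εj := by ring

/-- **pp. 183–184, the ℍ-input of (1.31) END-TO-END**: *"… can be bounded by B₃exp(−δ2M₂R_j)22d²ε_j < (β/10)ε_j"* —
`sH < (β/10)ε_j` from the inputs of `boundH130_of_ineq190` and the γ-clause of `B15GammaSmallness.ineq131_input_of_gamma`
((2.5) for `R_j` (a natural number, `B14.IsRj`), `0 < g_j ≤ γ`, `log γ⁻² ≥ 1`, `δ2M₂ ≥ 1`, `B₃22d²γ² < β/10`, `ε_j > 0`).
[cite: Balaban1989LargeFieldI, (1.31) p.184; Balaban1988Convergent, (2.5) p.255] -/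
theorem ineq131_input_of_ineq190_gamma {T : Type*} {bB : BlockNorm g FB} {bout : BlockNorm g FA}
    {dH : T → FB →ₗ[ℝ] FA} {C δ₀ σ τ c D B₃ δ M₂ d εj β γ gj : ℝ} {Lnat r R : ℕ}
    (h190 : ∀ t, Ineq190 bB bout (dH t) C δ₀) (hC : 0 ≤ C) (hd : ∀ a b : g.Site, 0 ≤ g.dist a b)
    (hrow : RowSum g σ c) (hτ : 0 ≤ τ) (hστ : σ + τ ≤ δ₀ / 8) (B : FB) (y : g.Site)
    (hm : ∀ y', bB.loc y' B ≤ 22 * d ^ 2 * εj) (hD : ∀ y', bB.loc y' B ≠ 0 → D ≤ g.dist y y')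
    {HB : FA} (hmv : ∀ s : ℝ, (∀ t, bout.loc y (dH t B) ≤ s) → bout.loc y HB ≤ s)
    (hgeom : δ * 2 * M₂ * R ≤ τ * D) (hCB : C * bB.κ * c ≤ B₃) (hB₃ : 0 ≤ B₃)
    (hr : 1 ≤ r) (hR : B14.IsRj Lnat r gj R) (hg : 0 < gj) (hgγ : gj ≤ γ) (hγe : 1 ≤ Real.log (γ ^ 2)⁻¹)
    (hc1 : 1 ≤ δ * 2 * M₂) (hε : 0 < εj) (hγ : B₃ * (22 * d ^ 2) * γ ^ 2 < β / 10) :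
    bout.loc y HB < β / 10 * εj := by
  have h1 := boundH130_of_ineq190 h190 hC hd hrow hτ hστ B y hm hD hmv hgeom hCB hB₃ hε.le
  exact h1.trans_lt (ineq131_input_of_gamma hr hR hg hgγ hγe hc1 hB₃ hε hγ)

end Literature.MathematicalPhysics.QuantumFieldTheory.Balaban1983to89.B15Ineq131Input
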